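import Literature.NumberTheory.Automorphic.PairLFunctionPolesRankNeTwist
import Literature.NumberTheory.Automorphic.GodementJacquetPartialLGL2
import HarnessLib

/-!
# Arthur–Clozel (2.2) at `s = 1` for `GL_n × GL_1`: the standard statement from Godement–Jacquet's
entire continuation and the non-vanishing at `1` (proofs only)

Topic `NumberTheory/Automorphic`; namespace `Literature.NumberTheory.Automorphic`. Proof file
(theorems only: no definition, no named fact, no instance) under the named fact
`JacquetShalika1981_partialPairL_at_one_of_rank_ne` of `PairLFunctionPoles` — Arthur–Clozel,
*Simple algebras, base change, and the advanced theory of the trace formula*, Ann. of Math.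
Stud. 120 (1989), Ch. 3 §2, (2.2), p. 171 of the held copy, at `s₀ = 1`, `n ≠ m` — continuing
`PairLFunctionPolesRankNeTwist`, which reduced the cases `GL_n × GL_1`, `GL_1 × GL_n` (and
unconditionally `GL₂ × GL₁`, `GL₁ × GL₂`) to the **standard statement** at `GL_n`: *for every
cuspidal `Π` of `GL_n(𝔸_K)`, every finite `S` and every Satake family `γ` of `Π` off `S`,
`L^S(s, Π)` has a finite non-zero limit as `s → 1`, `Re s > 1`.*

In print the standard statement is two theorems: the **holomorphy** of `L(s, Π)` at `s = 1` —
Godement–Jacquet, LNM 260 (1972), Thm. 13.8: `L(s, Π)` is entire for cuspidal `Π` of `GL_n`,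
`n ≥ 2` (Jacquet–Langlands (1970), Thm. 11.1 for `n = 2`), in the tree the named fact
`godementJacquet` of `AutomorphicLFunctions` (lang.S21, entire form) — and the **non-vanishing**
`L(1, Π) ≠ 0` — Jacquet–Shalika, *A non-vanishing theorem for zeta functions of `GL_n`*, Invent.
Math. 38 (1976), Theorem p. 1 ("`L_S(1 + it, π) ≠ 0`", Eisenstein series on `GL_{n+1}`), not in
the tree. This file separates them: the holomorphy half is derived from the named fact
`godementJacquet` (with Jacquet–Shalika's (5.3.3) `summable_normSq_trace_satakePow`, a theorem in
rank `≤ 2`), and the non-vanishing half is kept as the explicit hypothesis *every boundary value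
of a partial standard `L`-function of a cuspidal `Π` at `1` is non-zero* (D-0026: no new named
fact; it is the statement of Jacquet–Shalika (1976) at `t = 0`).

Contents (all proved):

* `partialStandardL_eq_partialPairL_one`, `satakePairPolynomial_one_right` — `L^S(s, α)` is the
  pair `L`-function `L^S(s, α ⊗ {1})`, so the change-of-`S` lemmas of `PairLFunctionPolesChangeOfS`
  apply to standard `L`-functions: `exists_ne_zero_tendsto_partialStandardL_of_subset`,
  `exists_ne_zero_tendsto_partialStandardL_of_supset`, and `partialStandardL_eq_of_isSatakeFamilyOf`
  (two Satake families of the same `Π` have the same `L^T` off both exceptional sets);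
* `StandardLFunctionData.exists_tendsto_partialStandardL_of_hasEntireContinuation` — **the
  boundary value from an entire continuation**: if `D.L` (the full `L`-function of a standard
  `L`-function datum `D` of `Π`, exceptional factors `P_v(q_v^{-s})⁻¹` at `v ∈ D.S` included) agrees
  on `Re s > 1` with an entire `g`, and (5.3.3) holds at `GL_n` (so that
  `L = (∏_{v ∈ S} P_v(q_v^{-s})⁻¹) · L^S` on `Re s > 1`, `L_eq_partialStandardL_mul_of_summable`), then
  `L^{D.S}(s, D.α) → g(s₀) ∏_{v ∈ D.S} P_v(q_v^{-s₀})` as `s → s₀`, `Re s > 1`, at every `s₀` with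
  `Re s₀ ≤ 1`. The only subtlety is that the exceptional factors of the datum are unconstrained
  polynomials with constant term `1`, whose product `F(s) = ∏ P_v(q_v^{-s})` may vanish at `s₀`; but
  `F` is entire and not identically zero (`F(x) ≠ 0` for `x` real large, `P_v(0) = 1`), so its
  zeros are isolated (`meromorphicOrderAt_ne_top_iff_eventually_ne_zero`) and `L^S = F · g` on a
  punctured neighbourhood within `Re s > 1`;
* `standard_at_one_of_godementJacquet_of_nonvanishing` — **the standard statement at `GL_n`,
  `n ≥ 2`, from `godementJacquet`, (5.3.3) and the non-vanishing of the boundary values at `1`**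
  (change of `S` by the lemmas above; the moved unramified factors `∏_{a}(1 - a q_v^{-1})` are
  non-zero by (5.1.3), `norm_satakeParameter_le_sqrt_of_summable`, `eval_eulerPolynomial_ne_zero_of_sqrt`);
  `standard_at_one_two_of_godementJacquet_of_nonvanishing` — rank `2`, where (5.3.3) is a theorem;
* `JacquetShalika1981_partialPairL_at_one_of_rank_ne_two_one_and_one_two_of_godementJacquet` —
  **`GL₂ × GL₁` and `GL₁ × GL₂`: the named fact from `godementJacquet` at `GL₂` and the
  non-vanishing at `1` of the partial standard `L`-functions of cuspidal representations of
  `GL₂(𝔸_K)`** (Jacquet–Shalika (1976) for `n = 2`) — the frontier of the smallest case of (2.2),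
  `n ≠ m`;
* `JacquetShalika1981_partialPairL_at_one_of_rank_ne_of_godementJacquet_of_normLt`,
  `…_left_of_godementJacquet` — `GL_n × GL_1` and `GL_1 × GL_n`, `n ≥ 2`: the fact from (5.3.3) at
  `GL_n`, Cor. (2.5) at `GL_n` (right order only), `godementJacquet` at `GL_n` and the non-vanishing
  at `1`.

## References

* J. Arthur, L. Clozel, *Simple algebras, base change, and the advanced theory of the trace
  formula*, Ann. of Math. Stud. 120 (1989), Ch. 3 §2, (2.2), p. 171. [ArthurClozelAMS120]
* R. Godement, H. Jacquet, *Zeta functions of simple algebras*, LNM 260 (1972), Thm. 13.8.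
  [GodementJacquet1972]
* H. Jacquet, J. A. Shalika, *A non-vanishing theorem for zeta functions of `GL_n`*, Invent. Math.
  38 (1976), 1–16, Theorem p. 1. [JacquetShalikaInvent1976]
* H. Jacquet, J. A. Shalika, *On Euler products and the classification of automorphic
  representations I*, Amer. J. Math. 103 (1981), Thm. (5.3), (5.3.3), (5.1.3). [JacquetShalikaAJM1981]
-/

noncomputable section

open scoped MatrixGroups Topology
open NumberField IsDedekindDomain MeasureTheory Filter Polynomial

namespace Literature.NumberTheory.Automorphic

open AdelicGroupData

/-! ### Standard `L`-functions as pair `L`-functions against `{1}`; change of `S` -/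

section Standard

variable {K : Type} [Field K] [NumberField K]

/-- `det(1 - A ⊗ {1} x) = det(1 - A x)`: the pair polynomial against the singleton `{1}` is the
standard Euler polynomial. [folklore] -/
theorem satakePairPolynomial_one_right (α : Multiset ℂ) :
    satakePairPolynomial α {1} = eulerPolynomial α := by
  rw [satakePairPolynomial_eq_eulerPolynomial, satakeTensor_singleton_right]
  simp only [one_mul, Multiset.map_id']

/-- `L^S(s, α) = L^S(s, α ⊗ {1})`: the partial standard `L`-function is the partial pair
`L`-function against the constant singleton family `{1}` (the Satake family of the trivial
character). [folklore] -/
theorem partialStandardL_eq_partialPairL_one (S : Set (HeightOneSpectrum (𝓞 K))) (α : SatakeFamily K) :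
    partialStandardL S α = partialPairL S α fun _ => {1} := by
  funext s
  simp only [partialStandardL, partialPairL, satakePairPolynomial_one_right]

/-- **Transfer of a non-zero boundary value of `L^S(s, Π)` down to a smaller `S`** (`S ⊆ S'`,
`S' ∖ S` finite): if the Euler product off `S'` is multipliable for `Re s > 1` near `s₀`, the moved
factors `∏_{a ∈ α v}(1 - a q_v^{-s₀})` are non-zero, and `L^{S'} → c ≠ 0` at `s₀` from `Re s > 1`,
then `L^S → c' ≠ 0` (`exists_ne_zero_tendsto_partialPairL_of_subset` against `{1}`). [folklore] -/
theorem exists_ne_zero_tendsto_partialStandardL_of_subset {S S' : Set (HeightOneSpectrum (𝓞 K))}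
    (hSS' : S ⊆ S') (hfin : (S' \ S).Finite) {α : SatakeFamily K} {s₀ : ℂ}
    (hmul : ∀ᶠ s in 𝓝[{s : ℂ | 1 < s.re}] s₀,
      Multipliable fun v : {v : HeightOneSpectrum (𝓞 K) // v ∉ S'} =>
        ((eulerPolynomial (α v.1)).eval ((v.1.residueCard : ℂ) ^ (-s)))⁻¹)
    (hne : ∀ v ∈ S' \ S, (eulerPolynomial (α v)).eval ((v.residueCard : ℂ) ^ (-s₀)) ≠ 0)
    (h : ∃ c : ℂ, c ≠ 0 ∧ Tendsto (partialStandardL S' α) (𝓝[{s : ℂ | 1 < s.re}] s₀) (𝓝 c)) :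
    ∃ c : ℂ, c ≠ 0 ∧ Tendsto (partialStandardL S α) (𝓝[{s : ℂ | 1 < s.re}] s₀) (𝓝 c) := by
  simp only [partialStandardL_eq_partialPairL_one] at h ⊢
  refine exists_ne_zero_tendsto_partialPairL_of_subset hSS' hfin ?_ ?_ h
  · simpa only [satakePairPolynomial_one_right] using hmul
  · simpa only [satakePairPolynomial_one_right] using hne

/-- **Transfer of a non-zero boundary value of `L^S(s, Π)` up to a larger `S`** (hypotheses as in
`exists_ne_zero_tendsto_partialStandardL_of_subset`; `exists_ne_zero_tendsto_partialPairL_of_supset`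
against `{1}`). [folklore] -/
theorem exists_ne_zero_tendsto_partialStandardL_of_supset {S S' : Set (HeightOneSpectrum (𝓞 K))}
    (hSS' : S ⊆ S') (hfin : (S' \ S).Finite) {α : SatakeFamily K} {s₀ : ℂ}
    (hmul : ∀ᶠ s in 𝓝[{s : ℂ | 1 < s.re}] s₀,
      Multipliable fun v : {v : HeightOneSpectrum (𝓞 K) // v ∉ S'} =>
        ((eulerPolynomial (α v.1)).eval ((v.1.residueCard : ℂ) ^ (-s)))⁻¹)
    (hne : ∀ v ∈ S' \ S, (eulerPolynomial (α v)).eval ((v.residueCard : ℂ) ^ (-s₀)) ≠ 0)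
    (h : ∃ c : ℂ, c ≠ 0 ∧ Tendsto (partialStandardL S α) (𝓝[{s : ℂ | 1 < s.re}] s₀) (𝓝 c)) :
    ∃ c : ℂ, c ≠ 0 ∧ Tendsto (partialStandardL S' α) (𝓝[{s : ℂ | 1 < s.re}] s₀) (𝓝 c) := by
  simp only [partialStandardL_eq_partialPairL_one] at h ⊢
  refine exists_ne_zero_tendsto_partialPairL_of_supset hSS' hfin ?_ ?_ h
  · simpa only [satakePairPolynomial_one_right] using hmul
  · simpa only [satakePairPolynomial_one_right] using hne

variable {n : ℕ} {μ : Measure (gl n K).automorphicQuotient} [(gl n K).IsAutomorphicMeasure μ]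

/-- Two Satake families of the same cuspidal `Π` have the same partial standard `L`-function off
any set `T` containing both exceptional sets (uniqueness of Hecke–Satake parameters,
`IsSatakeFamilyOf.eq_of_not_mem`). [folklore] -/
theorem partialStandardL_eq_of_isSatakeFamilyOf {P : CuspidalAutomorphicRepGL n K μ}
    {S S₀ T : Set (HeightOneSpectrum (𝓞 K))} (hST : S ⊆ T) (hS₀T : S₀ ⊆ T)
    {α α₀ : SatakeFamily K} (hα : IsSatakeFamilyOf P S α) (hα₀ : IsSatakeFamilyOf P S₀ α₀) :
    partialStandardL T α = partialStandardL T α₀ := by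
  funext s
  simp only [partialStandardL]
  refine tprod_congr fun v => ?_
  rw [hα.eq_of_not_mem hα₀ (fun h => v.2 (hST h)) (fun h => v.2 (hS₀T h))]

end Standard

/-! ### The boundary value of `L^S(s, Π)` from an entire continuation of `L(s, Π)` -/

section Boundary

variable {n : ℕ} {K : Type} [Field K] [NumberField K]
  {μ : Measure (gl n K).automorphicQuotient} [(gl n K).IsAutomorphicMeasure μ]

/-- **The boundary value from an entire continuation.** Let `D` be a standard `L`-function datum
of the cuspidal `Π` of `GL_n(𝔸_K)` whose full `L`-function `D.L` (junk-free on `Re s > 1`) agrees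
there with an entire function `g` (`HasEntireContinuation`, as delivered by the named fact
`godementJacquet`), and assume Jacquet–Shalika's (5.3.3) at `GL_n` (so that
`D.L = (∏_{v ∈ D.S} P_v(q_v^{-s})⁻¹) · L^{D.S}(s, D.α)` on `Re s > 1`,
`L_eq_partialStandardL_mul_of_summable`). Then at every `s₀` with `Re s₀ ≤ 1` the partial standard
`L`-function `L^{D.S}(s, D.α)` tends, as `s → s₀` with `Re s > 1`, to
`g(s₀) · ∏_{v ∈ D.S} P_v(q_v^{-s₀})`. The exceptional factors `P_v` of the datum are arbitrary
polynomials with `P_v(0) = 1`; their product `F(s) = ∏_{v ∈ D.S} P_v(q_v^{-s})` is entire and not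
identically zero (`F(x) ≠ 0` for large real `x`, as `q_v^{-x} → 0` and `P_v(0) = 1`), so its zeros
are isolated and `L^{D.S} = F · g` on a punctured neighbourhood of `s₀` within `Re s > 1`.
[cite: GodementJacquet1972, Thm. 13.8] -/
theorem StandardLFunctionData.exists_tendsto_partialStandardL_of_hasEntireContinuation
    (h₂ : summable_normSq_trace_satakePow (n := n) (K := K) (μ := μ))
    {P : CuspidalAutomorphicRepGL n K μ} (D : StandardLFunctionData P)
    (hD : GaloisRepresentations.LFunction.HasEntireContinuation D.L) {s₀ : ℂ} (hs₀ : s₀.re ≤ 1) :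
    ∃ c : ℂ, Tendsto (partialStandardL ↑D.S D.α) (𝓝[{s : ℂ | 1 < s.re}] s₀) (𝓝 c) := by
  classical
  obtain ⟨g, hg, hgL⟩ := hD
  -- the product of the exceptional factors
  set F : ℂ → ℂ := fun s => ∏ v ∈ D.S, (D.localFactor v).eval ((v.residueCard : ℂ) ^ (-s))
    with hF
  have hq0 : ∀ v : HeightOneSpectrum (𝓞 K), ((v.residueCard : ℕ) : ℂ) ≠ 0 := fun v =>
    Nat.cast_ne_zero.mpr (zero_lt_one.trans v.one_lt_residueCard).ne'
  have hFd : Differentiable ℂ F := by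
    refine Differentiable.fun_finsetProd fun v _ => ?_
    exact (D.localFactor v).differentiable.comp (differentiable_id.neg.const_cpow (Or.inl (hq0 v)))
  -- `F` is not identically zero: `F(x) ≠ 0` for large real `x`
  have hF₀ : ∃ s₁ : ℂ, F s₁ ≠ 0 := by
    have hv : ∀ v ∈ D.S, ∀ᶠ x : ℝ in atTop,
        (D.localFactor v).eval ((v.residueCard : ℂ) ^ (-(x : ℂ))) ≠ 0 := by
      intro v _
      have hne : ∀ᶠ w in 𝓝 (0 : ℂ), (D.localFactor v).eval w ≠ 0 :=
        (D.localFactor v).continuous.continuousAt.eventually_ne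
          (by rw [D.eval_zero_localFactor]; exact one_ne_zero)
      have hq1 : (1 : ℝ) < (v.residueCard : ℝ) := by exact_mod_cast v.one_lt_residueCard
      have ht : Tendsto (fun x : ℝ => (v.residueCard : ℂ) ^ (-(x : ℂ))) atTop (𝓝 0) := by
        rw [tendsto_zero_iff_norm_tendsto_zero]
        have heq : (fun x : ℝ => ‖(v.residueCard : ℂ) ^ (-(x : ℂ))‖) =
            fun x : ℝ => (v.residueCard : ℝ) ^ (-x) := by
          funext x
          rw [Complex.norm_natCast_cpow_of_pos (zero_lt_one.trans v.one_lt_residueCard), Complex.neg_re,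
            Complex.ofReal_re]
        rw [heq]
        exact (tendsto_rpow_atBot_of_base_gt_one _ hq1).comp tendsto_neg_atTop_atBot
      exact ht.eventually hne
    have hall : ∀ᶠ x : ℝ in atTop, ∀ v ∈ D.S,
        (D.localFactor v).eval ((v.residueCard : ℂ) ^ (-(x : ℂ))) ≠ 0 :=
      (eventually_all_finset D.S).mpr hv
    obtain ⟨x, hx⟩ := hall.exists
    exact ⟨(x : ℂ), Finset.prod_ne_zero_iff.mpr fun v hv' => hx v hv'⟩
  -- hence its zeros are isolated
  have hFev : ∀ᶠ s in 𝓝[≠] s₀, F s ≠ 0 := by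
    obtain ⟨s₁, hs₁⟩ := hF₀
    have hmer : MeromorphicOn F Set.univ := fun s _ => (hFd.analyticAt s).meromorphicAt
    have h₁ : meromorphicOrderAt F s₁ ≠ ⊤ := by
      rw [meromorphicOrderAt_ne_top_iff_eventually_ne_zero (hmer s₁ (Set.mem_univ _))]
      exact eventually_nhdsWithin_of_eventually_nhds
        ((hFd.continuous.continuousAt).eventually_ne hs₁)
    have h₀ : meromorphicOrderAt F s₀ ≠ ⊤ :=
      hmer.meromorphicOrderAt_ne_top_of_isPreconnected isPreconnected_univ (Set.mem_univ s₁)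
        (Set.mem_univ s₀) h₁
    exact (meromorphicOrderAt_ne_top_iff_eventually_ne_zero (hmer s₀ (Set.mem_univ _))).mp h₀
  have hFev' : ∀ᶠ s in 𝓝[{s : ℂ | 1 < s.re}] s₀, F s ≠ 0 := by
    have hsub : {s : ℂ | 1 < s.re} ⊆ ({s₀}ᶜ : Set ℂ) := by
      intro s hs h
      rw [Set.mem_singleton_iff] at h
      rw [Set.mem_setOf_eq, h] at hs
      exact absurd hs (not_lt.mpr hs₀)
    exact nhdsWithin_mono s₀ hsub hFev
  -- the identity `L^S = F · g` on a punctured neighbourhood within `Re s > 1`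
  have hid : ∀ᶠ s in 𝓝[{s : ℂ | 1 < s.re}] s₀, F s * g s = partialStandardL ↑D.S D.α s := by
    filter_upwards [hFev', self_mem_nhdsWithin] with s hFs hs
    have hL := StandardLFunctionData.L_eq_partialStandardL_mul_of_summable h₂ D hs
    rw [hgL s hs, hL, Finset.prod_inv_distrib, ← mul_assoc, mul_inv_cancel₀ hFs, one_mul]
  refine ⟨F s₀ * g s₀, ?_⟩
  have hcont : Tendsto (fun s => F s * g s) (𝓝 s₀) (𝓝 (F s₀ * g s₀)) :=
    (hFd.continuous.mul hg.continuous).tendsto s₀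
  exact (hcont.mono_left nhdsWithin_le_nhds).congr' hid

end Boundary

/-! ### The standard statement at `s = 1` from `godementJacquet` and the non-vanishing -/

section StandardStatement

variable {n : ℕ} {K : Type} [Field K] [NumberField K]
  {μ : Measure (gl n K).automorphicQuotient} [(gl n K).IsAutomorphicMeasure μ]

/-- **The standard statement at `GL_n`, `n ≥ 2`, from Godement–Jacquet and the non-vanishing at
`1`.** Assume: the named fact `godementJacquet` at `GL_n` (LNM 260, Thm. 13.8: for cuspidal `Π`
of `GL_n`, `n ≥ 2`, some standard `L`-function datum has entire `L(s, Π)`); Jacquet–Shalika's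
(5.3.3) `summable_normSq_trace_satakePow` at `GL_n` (a theorem in rank `≤ 2`); and the
**non-vanishing at `1`**: every boundary value `lim_{s → 1, Re s > 1} L^S(s, Π)` of a partial
standard `L`-function of a cuspidal `Π` of `GL_n(𝔸_K)` (finite `S`, honest Satake family) is
non-zero — Jacquet–Shalika (1976), Theorem, at `t = 0`. Then for every cuspidal `Π`, every finite
`S` and every Satake family `γ` of `Π` off `S`, `L^S(s, Π) → c ≠ 0` as `s → 1`, `Re s > 1`.
Proof: the datum `D` of `godementJacquet` gives the boundary value of `L^{D.S}(s, D.α)` at `1`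
(`exists_tendsto_partialStandardL_of_hasEntireContinuation`), non-zero by hypothesis; move up to
`D.S ∪ S`, where `L^{D.S ∪ S}(D.α) = L^{D.S ∪ S}(γ)` (uniqueness of Hecke–Satake parameters), and
down to `S`, the moved unramified factors `∏_a (1 - a q_v^{-1})` being non-zero by (5.1.3)
(`norm_satakeParameter_le_sqrt_of_summable`, `eval_eulerPolynomial_ne_zero_of_sqrt`) and the Euler
products multipliable on `Re s > 1` (`multipliable_partialStandardL_of_summable`).
[cite: GodementJacquet1972, Thm. 13.8] [cite: JacquetShalikaInvent1976, Theorem p. 1]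
[cite: JacquetShalikaAJM1981, Thm. (5.3), (5.1.3)] -/
theorem standard_at_one_of_godementJacquet_of_nonvanishing (hn : 2 ≤ n)
    (hGJ : godementJacquet (n := n) (K := K) (μ := μ))
    (h₂ : summable_normSq_trace_satakePow (n := n) (K := K) (μ := μ))
    (hNV : ∀ (Q : CuspidalAutomorphicRepGL n K μ) {S : Set (HeightOneSpectrum (𝓞 K))}
      (_hS : S.Finite) {γ : SatakeFamily K} (_hγ : IsSatakeFamilyOf Q S γ) {c : ℂ},
      Tendsto (partialStandardL S γ) (𝓝[{s : ℂ | 1 < s.re}] 1) (𝓝 c) → c ≠ 0)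
    (Q : CuspidalAutomorphicRepGL n K μ) {S : Set (HeightOneSpectrum (𝓞 K))} (hS : S.Finite)
    {γ : SatakeFamily K} (hγ : IsSatakeFamilyOf Q S γ) :
    ∃ c : ℂ, c ≠ 0 ∧ Tendsto (partialStandardL S γ) (𝓝[{s : ℂ | 1 < s.re}] 1) (𝓝 c) := by
  obtain ⟨D, hD, -⟩ := hGJ Q (Or.inl hn)
  obtain ⟨c₀, hc₀⟩ := D.exists_tendsto_partialStandardL_of_hasEntireContinuation h₂ hD
    (s₀ := 1) (by simp)
  have hc₀ne : c₀ ≠ 0 := hNV Q D.S.finite_toSet D.isSatakeFamily hc₀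
  -- the common set `B = D.S ∪ S`
  set B : Set (HeightOneSpectrum (𝓞 K)) := ↑D.S ∪ S with hB
  have hBfin : B.Finite := D.S.finite_toSet.union hS
  have hαB : IsSatakeFamilyOf Q B D.α := D.isSatakeFamily.mono Set.subset_union_left
  have hγB : IsSatakeFamilyOf Q B γ := hγ.mono Set.subset_union_right
  -- non-vanishing of unramified factors at `s₀ = 1`, from (5.1.3)
  have hne : ∀ {T : Set (HeightOneSpectrum (𝓞 K))} {δ : SatakeFamily K} (_hδ : IsSatakeFamilyOf Q T δ)
      {v : HeightOneSpectrum (𝓞 K)} (_hv : v ∉ T),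
      (eulerPolynomial (δ v)).eval ((v.residueCard : ℂ) ^ (-(1 : ℂ))) ≠ 0 :=
    fun hδ v hv => eval_eulerPolynomial_ne_zero_of_sqrt v.one_lt_residueCard
      (fun a ha => norm_satakeParameter_le_sqrt_of_summable h₂ Q hδ hv ha)
      (by rw [Complex.one_re]; norm_num)
  -- multipliability off `B` on `Re s > 1`
  have hmul : ∀ {δ : SatakeFamily K} (_hδ : IsSatakeFamilyOf Q B δ),
      ∀ᶠ s in 𝓝[{s : ℂ | 1 < s.re}] (1 : ℂ),
        Multipliable fun v : {v : HeightOneSpectrum (𝓞 K) // v ∉ B} =>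
          ((eulerPolynomial (δ v.1)).eval ((v.1.residueCard : ℂ) ^ (-s)))⁻¹ :=
    fun hδ => eventually_nhdsWithin_of_forall fun s hs =>
      multipliable_partialStandardL_of_summable h₂ Q hδ hs
  -- up from `D.S` to `B` with the family `D.α`
  have h1 : ∃ c : ℂ, c ≠ 0 ∧ Tendsto (partialStandardL B D.α) (𝓝[{s : ℂ | 1 < s.re}] 1) (𝓝 c) :=
    exists_ne_zero_tendsto_partialStandardL_of_supset Set.subset_union_left
      (hBfin.subset fun v hv => hv.1) (hmul hαB) (fun v hv => hne D.isSatakeFamily hv.2)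
      ⟨c₀, hc₀ne, hc₀⟩
  -- `L^B(D.α) = L^B(γ)`
  rw [partialStandardL_eq_of_isSatakeFamilyOf Set.subset_union_left Set.subset_union_right
    D.isSatakeFamily hγ] at h1
  -- down from `B` to `S` with the family `γ`
  exact exists_ne_zero_tendsto_partialStandardL_of_subset Set.subset_union_right
    (hBfin.subset fun v hv => hv.1) (hmul hγB) (fun v hv => hne hγ hv.2) h1

/-- **The standard statement at `GL₂` from `godementJacquet` at `GL₂` and the non-vanishing at
`1`** — (5.3.3) being a theorem of the tree in rank `2` (`summable_normSq_trace_satakePow_two`).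
[cite: GodementJacquet1972, Thm. 13.8] [cite: JacquetShalikaInvent1976, Theorem p. 1] -/
theorem standard_at_one_two_of_godementJacquet_of_nonvanishing
    {μ₂ : Measure (gl 2 K).automorphicQuotient} [(gl 2 K).IsAutomorphicMeasure μ₂]
    (hGJ : godementJacquet (n := 2) (K := K) (μ := μ₂))
    (hNV : ∀ (Q : CuspidalAutomorphicRepGL 2 K μ₂) {S : Set (HeightOneSpectrum (𝓞 K))}
      (_hS : S.Finite) {γ : SatakeFamily K} (_hγ : IsSatakeFamilyOf Q S γ) {c : ℂ},
      Tendsto (partialStandardL S γ) (𝓝[{s : ℂ | 1 < s.re}] 1) (𝓝 c) → c ≠ 0)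
    (Q : CuspidalAutomorphicRepGL 2 K μ₂) {S : Set (HeightOneSpectrum (𝓞 K))} (hS : S.Finite)
    {γ : SatakeFamily K} (hγ : IsSatakeFamilyOf Q S γ) :
    ∃ c : ℂ, c ≠ 0 ∧ Tendsto (partialStandardL S γ) (𝓝[{s : ℂ | 1 < s.re}] 1) (𝓝 c) :=
  standard_at_one_of_godementJacquet_of_nonvanishing le_rfl hGJ summable_normSq_trace_satakePow_two
    hNV Q hS hγ

end StandardStatement

/-! ### (2.2) at `s = 1` for `GL₂ × GL₁`, `GL₁ × GL₂`, `GL_n × GL_1`, `GL_1 × GL_n` -/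

section Consequences

variable {n : ℕ} {K : Type} [Field K] [NumberField K]
  {μ : Measure (gl n K).automorphicQuotient} [(gl n K).IsAutomorphicMeasure μ]
  {μ₁ : Measure (gl 1 K).automorphicQuotient} [(gl 1 K).IsAutomorphicMeasure μ₁]

/-- **Arthur–Clozel (2.2) at `s = 1` for `GL₂ × GL₁` and `GL₁ × GL₂` from Godement–Jacquet at
`GL₂` and the non-vanishing at `1`.** The named fact `JacquetShalika1981_partialPairL_at_one_of_rank_ne`
for `(n, m) = (2, 1)` and `(1, 2)` follows from the named fact `godementJacquet` at `GL₂`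
(Godement–Jacquet (1972), Thm. 13.8 / Jacquet–Langlands (1970), Thm. 11.1: `L(s, Π)` entire) and
the non-vanishing at `1` of the boundary values of the partial standard `L`-functions of the
cuspidal representations of `GL₂(𝔸_K)` (Jacquet–Shalika (1976), Theorem, `n = 2`, `t = 0`); every
other input of the printed proof is a theorem of the tree
(`JacquetShalika1981_partialPairL_at_one_of_rank_ne_two_one_and_one_two_of_standard`,
`standard_at_one_two_of_godementJacquet_of_nonvanishing`).
[cite: ArthurClozelAMS120, Ch. 3 §2 (2.2)] [cite: GodementJacquet1972, Thm. 13.8]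
[cite: JacquetShalikaInvent1976, Theorem p. 1] -/
theorem JacquetShalika1981_partialPairL_at_one_of_rank_ne_two_one_and_one_two_of_godementJacquet
    {μ₂ : Measure (gl 2 K).automorphicQuotient} [(gl 2 K).IsAutomorphicMeasure μ₂]
    (hGJ : godementJacquet (n := 2) (K := K) (μ := μ₂))
    (hNV : ∀ (Q : CuspidalAutomorphicRepGL 2 K μ₂) {S : Set (HeightOneSpectrum (𝓞 K))}
      (_hS : S.Finite) {γ : SatakeFamily K} (_hγ : IsSatakeFamilyOf Q S γ) {c : ℂ},
      Tendsto (partialStandardL S γ) (𝓝[{s : ℂ | 1 < s.re}] 1) (𝓝 c) → c ≠ 0) :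
    JacquetShalika1981_partialPairL_at_one_of_rank_ne (n := 2) (m := 1) (K := K) (μ := μ₂)
        (μ' := μ₁) ∧
      JacquetShalika1981_partialPairL_at_one_of_rank_ne (n := 1) (m := 2) (K := K) (μ := μ₁)
        (μ' := μ₂) :=
  JacquetShalika1981_partialPairL_at_one_of_rank_ne_two_one_and_one_two_of_standard
    fun Q _ hS _ hγ => standard_at_one_two_of_godementJacquet_of_nonvanishing hGJ hNV Q hS hγ

/-- **`GL_n × GL_1`, `n ≥ 2`, from (5.3.3) and Cor. (2.5) at `GL_n`, `godementJacquet` at `GL_n`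
and the non-vanishing at `1`** (`JacquetShalika1981_partialPairL_at_one_of_rank_ne_of_summable_of_normLt`
with the datum from `exists_one_family_datum_of_standard` and
`standard_at_one_of_godementJacquet_of_nonvanishing`). [cite: ArthurClozelAMS120, Ch. 3 §2 (2.2)]
[cite: GodementJacquet1972, Thm. 13.8] [cite: JacquetShalikaInvent1976, Theorem p. 1] -/
theorem JacquetShalika1981_partialPairL_at_one_of_rank_ne_of_godementJacquet_of_normLt (hn : 2 ≤ n)
    (h₂ : summable_normSq_trace_satakePow (n := n) (K := K) (μ := μ))
    (hB : ∀ (v : HeightOneSpectrum (𝓞 K)) {V : Type} [AddCommGroup V] [Module ℂ V]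
      (ρ : Representation ℂ (GL (Fin n) (v.adicCompletion K)) V),
      JacquetShalika1981_norm_lt_sqrt_of_isGeneric ρ)
    (hGJ : godementJacquet (n := n) (K := K) (μ := μ))
    (hNV : ∀ (Q : CuspidalAutomorphicRepGL n K μ) {S : Set (HeightOneSpectrum (𝓞 K))}
      (_hS : S.Finite) {γ : SatakeFamily K} (_hγ : IsSatakeFamilyOf Q S γ) {c : ℂ},
      Tendsto (partialStandardL S γ) (𝓝[{s : ℂ | 1 < s.re}] 1) (𝓝 c) → c ≠ 0) :
    JacquetShalika1981_partialPairL_at_one_of_rank_ne (n := n) (m := 1) (K := K) (μ := μ)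
      (μ' := μ₁) :=
  JacquetShalika1981_partialPairL_at_one_of_rank_ne_of_summable_of_normLt h₂
    (summable_normSq_trace_satakePow_of_le_one le_rfl) hB
    fun _ _ _ P P' => exists_one_family_datum_of_standard
      (fun Q _ hS _ hγ => standard_at_one_of_godementJacquet_of_nonvanishing hn hGJ h₂ hNV Q hS hγ)
      P P'

/-- **`GL_1 × GL_n`, `n ≥ 2`, from (5.3.3) at `GL_n`, `godementJacquet` at `GL_n` and the
non-vanishing at `1`** (all inputs at `GL_1` are theorems; the datum for `(χ, π)` is
`exists_one_family_datum_of_standard_left`). [cite: ArthurClozelAMS120, Ch. 3 §2 (2.2)]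
[cite: GodementJacquet1972, Thm. 13.8] [cite: JacquetShalikaInvent1976, Theorem p. 1] -/
theorem JacquetShalika1981_partialPairL_at_one_of_rank_ne_left_of_godementJacquet (hn : 2 ≤ n)
    (h₂ : summable_normSq_trace_satakePow (n := n) (K := K) (μ := μ))
    (hGJ : godementJacquet (n := n) (K := K) (μ := μ))
    (hNV : ∀ (Q : CuspidalAutomorphicRepGL n K μ) {S : Set (HeightOneSpectrum (𝓞 K))}
      (_hS : S.Finite) {γ : SatakeFamily K} (_hγ : IsSatakeFamilyOf Q S γ) {c : ℂ},
      Tendsto (partialStandardL S γ) (𝓝[{s : ℂ | 1 < s.re}] 1) (𝓝 c) → c ≠ 0) :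
    JacquetShalika1981_partialPairL_at_one_of_rank_ne (n := 1) (m := n) (K := K) (μ := μ₁)
      (μ' := μ) :=
  JacquetShalika1981_partialPairL_at_one_of_rank_ne_of_summable_of_normLt
    (summable_normSq_trace_satakePow_of_le_one le_rfl) h₂
    (fun _ _ _ _ ρ => JacquetShalika1981_norm_lt_sqrt_of_isGeneric_of_le_one le_rfl ρ)
    fun _ _ _ P' P => exists_one_family_datum_of_standard_left
      (fun Q _ hS _ hγ => standard_at_one_of_godementJacquet_of_nonvanishing hn hGJ h₂ hNV Q hS hγ)
      P' P

end Consequences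

end Literature.NumberTheory.Automorphic
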